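import Literature.NumberTheory.EllipticCurves.Smith2016.CongruentNumberGenusDeterminantRowsTwoThree
import Literature.NumberTheory.EllipticCurves.Smith2016.CongruentNumberMonskyDeterminantSelmer
import Literature.NumberTheory.EllipticCurves.Smith2016.CongruentNumberGenusDeterminantTwoPrimes
import Literature.NumberTheory.EllipticCurves.Tian2014.ClassSixFamilyDescentProofs
import HarnessLib

/-!
# Tian–Yuan–Zhang (journal) Thm. 1.2 = Smith Thm. 4.1 / Cor. 4.2 on `n ≡ 2, 3 (mod 8)` RELATIVE TO the identities `smith_thm22_rowTwo / rowThree`, and those identities DISCHARGED for one odd prime factor (`n = p ≡ 3 (8)`, `n = 2p ≡ 2 (8)`)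

Topic `NumberTheory/EllipticCurves`, namespace `Literature.NumberTheory.EllipticCurves.Smith2016`.
A pure proof file (theorems only), the rows-`2`/`3` twin of `CongruentNumberGenusDeterminantConsequences`:
it composes the curve side `#Sel⁽²⁾(E⁽ⁿ⁾) = 4 ⟺ det M = 1 ⟺ rank 0 ∧ Ш[2^∞] = 0` (Monsky's matrices, every
square-free `n`; `CongruentNumberMonskyDeterminantSelmer`) with the named facts `smith_thm22_rowTwo`,
`smith_thm22_rowThree` (`ℒ_x(n) ≡ det M (mod 2)`, Smith 2016 Thm. 2.2 rows 2, 3 with §2 L65–L75), and PROVES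
those identities for one odd prime factor by Rédei–Reichardt (tree theorem) and Heath-Brown's one-prime
tables (tree theorems `monskySelmerRankOdd/Even_prime`).

## What is proved

Relative to the identity of the row (no `L`-function): for `n = ∏ pᵢ ≡ 3 (mod 8)` resp. `n = 2∏ pᵢ ≡ 2 (mod 8)`
and every `k`, and for every square-free `N ≡ 3` resp. `2 (mod 8)`,
`rank E⁽ⁿ⁾(ℚ) = 0 ∧ Ш(E⁽ⁿ⁾/ℚ)[2^∞] = 0 ⟺ #Sel⁽²⁾(E⁽ⁿ⁾/ℚ) = 4 ⟺ Σ∏g(dᵢ)` odd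
(`rank_zero_and_sha_iff_odd_genusSum₁_of_smith_rowThree/rowTwo(')`).
Unconditionally (`k = 1`):
* `odd_genusClassNumber_genusField_prime_three_mod_four` — `g(p)` is odd for every prime `p ≡ 3 (mod 4)`
  (`RM(−p)` is `1 × 1`, `r₄ = 0`); **`smith_thm22_rowThree_prime`** — `ℒ₃(p) = g(p) ≡ 1 = det M` for `p ≡ 3 (8)`;
* `odd_genusClassNumber_genusField_two_mul_prime_iff` — for a prime `p ≡ 1 (mod 4)`, `g(2p)` is odd iff
  `p ≡ 5 (mod 8)` (`RM(−8p) = ((2/p)₊)·(1 1; 1 1)`); **`smith_thm22_rowTwo_prime`** — `ℒ₂(2p) ≡ det M (mod 2)`;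
* **`rank_zero_and_sha_two_mul_prime_iff_five_mod_eight`** — for a prime `p ≡ 1 (mod 4)`:
  `rank E_{2p}(ℚ) = 0 ∧ Ш(E_{2p}/ℚ)[2^∞] = 0 ⟺ p ≡ 5 (mod 8)` (Genocchi's `2p₅`; and for `p ≡ 1 (8)`, e.g. `34`,
  `82`, the curve has positive rank or non-trivial `Ш[2^∞]`).

Cell `bsd-monsky` (prover-B g17).  AI provenance: written by an AI assistant; no human has reviewed it.

## References
* [Smith2016CongruentDensity] A. Smith, arXiv:1603.08479v2, §1 Thm. 1.2, §2 Thm. 2.2 and L65–L75.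
* [TianYuanZhang2017] Asian J. Math. 21 (2017), Thm. 1.2 (journal numbering).
* [HeathBrown1994SelmerCongruentII] §1 typescript p. 6 L26–L28 (`s(p)`, `s(2p)`); Appendix (Monsky).
* [LiMa2008] Acta Arith. 134 (2008), Thm. 0.4 (Rédei–Reichardt), Lemma 0.1 (`D = −p, −8p`).
* [Feng1996NonCongruent] Acta Arith. 75 (1996), §1 p. 72 (Genocchi: `p₃`, `2p₅`).
-/

open scoped Classical

open Matrix Finset
open Literature.NumberTheory.EllipticCurves.HeathBrown1994
open Literature.NumberTheory.EllipticCurves.MonskySelmerParity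
open Literature.NumberTheory.EllipticCurves.TianYuanZhang2017
open Literature.NumberTheory.EllipticCurves.Tian2014 (IsQuadraticFieldOfSqrt odd_genusClassNumber_iff_card_ker_eq_two
  odd_genusClassNumber_two)
open Literature.NumberTheory.QuadraticFields.RedeiReichardt

namespace Literature.NumberTheory.EllipticCurves.Smith2016

/-! ## §1 Rows `3` and `2` relative to their identities (every `k`) -/

section Relative

variable {k : ℕ} (p : Fin k → ℕ)

/-- **TYZ (journal) Thm. 1.2 on `n ≡ 3 (mod 8)`, relative to `smith_thm22_rowThree` alone**: for
`n = p₁⋯p_k ≡ 3 (mod 8)`, `rank E⁽ⁿ⁾(ℚ) = 0 ∧ Ш(E⁽ⁿ⁾/ℚ)[2^∞] = 0 ⟺ Σ∏g(dᵢ)` odd.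
[cite: TianYuanZhang2017, Thm. 1.2 (journal numbering)] [cite: Smith2016CongruentDensity, Thm. 1.2, Thm. 2.2 row 3] -/
theorem rank_zero_and_sha_iff_odd_genusSum₁_of_smith_rowThree (h3 : smith_thm22_rowThree)
    (hp : ∀ i, (p i).Prime) (hodd : ∀ i, Odd (p i)) (hinj : Function.Injective p) (h8 : (∏ i, p i) % 8 = 3) :
    ((haveI := isElliptic_congruentNumberCurve (Squarefree.ne_zero (squarefree_prod_of_injective p hp hinj));
        (congruentNumberCurve (∏ i, p i)).mordellWeilRank = 0) ∧
      (haveI := isElliptic_congruentNumberCurve (Squarefree.ne_zero (squarefree_prod_of_injective p hp hinj));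
        AddCommGroup.primaryComponent (congruentNumberCurve (∏ i, p i)).sha 2 = ⊥)) ↔
      Odd (genusSum₁ (∏ i, p i) fun d => genusClassNumber (GenusField d)) := by
  rw [rank_zero_and_sha_iff_det_monskyMatrixOdd p hp hodd hinj, ← ZMod.natCast_eq_one_iff_odd,
    h3 k p hp hodd hinj h8]

/-- **TYZ (journal) Thm. 1.2 on `n ≡ 2 (mod 8)`, relative to `smith_thm22_rowTwo` alone**: for
`n = 2p₁⋯p_k ≡ 2 (mod 8)`, `rank E⁽ⁿ⁾(ℚ) = 0 ∧ Ш(E⁽ⁿ⁾/ℚ)[2^∞] = 0 ⟺ Σ∏g(dᵢ)` odd.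
[cite: TianYuanZhang2017, Thm. 1.2 (journal numbering)] [cite: Smith2016CongruentDensity, Thm. 1.2, Thm. 2.2 row 2] -/
theorem rank_zero_and_sha_iff_odd_genusSum₁_of_smith_rowTwo (h2 : smith_thm22_rowTwo)
    (hp : ∀ i, (p i).Prime) (hodd : ∀ i, Odd (p i)) (hinj : Function.Injective p) (h4 : (∏ i, p i) % 4 = 1) :
    ((haveI := isElliptic_congruentNumberCurve
        (Squarefree.ne_zero (squarefree_two_mul_prod_of_injective p hp hodd hinj));
        (congruentNumberCurve (2 * ∏ i, p i)).mordellWeilRank = 0) ∧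
      (haveI := isElliptic_congruentNumberCurve
        (Squarefree.ne_zero (squarefree_two_mul_prod_of_injective p hp hodd hinj));
        AddCommGroup.primaryComponent (congruentNumberCurve (2 * ∏ i, p i)).sha 2 = ⊥)) ↔
      Odd (genusSum₁ (2 * ∏ i, p i) fun d => genusClassNumber (GenusField d)) := by
  rw [rank_zero_and_sha_iff_det_monskyMatrixEven p hp hodd hinj, ← ZMod.natCast_eq_one_iff_odd,
    h2 k p hp hodd hinj h4]

/-- `#Sel⁽²⁾ = 4 ⟺ Σ∏g odd`, `n ≡ 3 (mod 8)`, relative to the row-3 identity.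
[cite: Smith2016CongruentDensity, Thm. 1.2, Thm. 2.2 row 3] -/
theorem card_selmerGroup_two_eq_four_iff_odd_genusSum₁_of_smith_rowThree (h3 : smith_thm22_rowThree)
    (hp : ∀ i, (p i).Prime) (hodd : ∀ i, Odd (p i)) (hinj : Function.Injective p) (h8 : (∏ i, p i) % 8 = 3) :
    Nat.card ((congruentNumberCurve (∏ i, p i)).selmerGroup 2) = 4 ↔
      Odd (genusSum₁ (∏ i, p i) fun d => genusClassNumber (GenusField d)) := by
  rw [card_selmerGroup_two_eq_four_iff_det_monskyMatrixOdd p hp hodd hinj, ← ZMod.natCast_eq_one_iff_odd,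
    h3 k p hp hodd hinj h8]

/-- `#Sel⁽²⁾ = 4 ⟺ Σ∏g odd`, `n ≡ 2 (mod 8)`, relative to the row-2 identity.
[cite: Smith2016CongruentDensity, Thm. 1.2, Thm. 2.2 row 2] -/
theorem card_selmerGroup_two_eq_four_iff_odd_genusSum₁_of_smith_rowTwo (h2 : smith_thm22_rowTwo)
    (hp : ∀ i, (p i).Prime) (hodd : ∀ i, Odd (p i)) (hinj : Function.Injective p) (h4 : (∏ i, p i) % 4 = 1) :
    Nat.card ((congruentNumberCurve (2 * ∏ i, p i)).selmerGroup 2) = 4 ↔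
      Odd (genusSum₁ (2 * ∏ i, p i) fun d => genusClassNumber (GenusField d)) := by
  rw [card_selmerGroup_two_eq_four_iff_det_monskyMatrixEven p hp hodd hinj, ← ZMod.natCast_eq_one_iff_odd,
    h2 k p hp hodd hinj h4]

end Relative

/-- **Enumeration-free, `N ≡ 3 (mod 8)`**: for every square-free `N ≡ 3 (mod 8)`, relative to the row-3 identity,
`rank E_N(ℚ) = 0 ∧ Ш(E_N/ℚ)[2^∞] = 0 ⟺ Σ∏g(dᵢ)` odd. [cite: TianYuanZhang2017, Thm. 1.2 (journal numbering)] -/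
theorem rank_zero_and_sha_iff_odd_genusSum₁_of_smith_rowThree' (h3 : smith_thm22_rowThree) {N : ℕ}
    (hN : Squarefree N) (h8 : N % 8 = 3) :
    ((haveI := isElliptic_congruentNumberCurve (Squarefree.ne_zero hN);
        (congruentNumberCurve N).mordellWeilRank = 0) ∧
      (haveI := isElliptic_congruentNumberCurve (Squarefree.ne_zero hN);
        AddCommGroup.primaryComponent (congruentNumberCurve N).sha 2 = ⊥)) ↔
      Odd (genusSum₁ N fun d => genusClassNumber (GenusField d)) := by
  obtain ⟨k, p, hp, hp2, hinj, hprod⟩ := exists_odd_prime_family_of_squarefree hN (Nat.odd_iff.mpr (by omega))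
  have hodd : ∀ i, Odd (p i) := fun i => (hp i).odd_of_ne_two (hp2 i)
  subst hprod
  exact rank_zero_and_sha_iff_odd_genusSum₁_of_smith_rowThree p h3 hp hodd hinj h8

/-- **Enumeration-free, `N ≡ 2 (mod 8)`**: for every square-free `N ≡ 2 (mod 8)`, relative to the row-2 identity,
`rank E_N(ℚ) = 0 ∧ Ш(E_N/ℚ)[2^∞] = 0 ⟺ Σ∏g(dᵢ)` odd. [cite: TianYuanZhang2017, Thm. 1.2 (journal numbering)] -/
theorem rank_zero_and_sha_iff_odd_genusSum₁_of_smith_rowTwo' (h2 : smith_thm22_rowTwo) {N : ℕ}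
    (hN : Squarefree N) (h8 : N % 8 = 2) :
    ((haveI := isElliptic_congruentNumberCurve (Squarefree.ne_zero hN);
        (congruentNumberCurve N).mordellWeilRank = 0) ∧
      (haveI := isElliptic_congruentNumberCurve (Squarefree.ne_zero hN);
        AddCommGroup.primaryComponent (congruentNumberCurve N).sha 2 = ⊥)) ↔
      Odd (genusSum₁ N fun d => genusClassNumber (GenusField d)) := by
  obtain ⟨k, p, hp, hp2, hinj, hprod⟩ :=
    exists_odd_prime_family_of_squarefree_even hN (Nat.even_iff.mpr (by omega))
  have hodd : ∀ i, Odd (p i) := fun i => (hp i).odd_of_ne_two (hp2 i)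
  subst hprod
  have h4 : (∏ i, p i) % 4 = 1 := by
    have hodd' : (∏ i, p i) % 2 = 1 := Nat.odd_iff.mp (odd_prod p hp hp2)
    omega
  exact rank_zero_and_sha_iff_odd_genusSum₁_of_smith_rowTwo p h2 hp hodd hinj h4

/-! ## §2 One odd prime: `n = p ≡ 3 (mod 8)` — row `3` HOLDS -/

section OnePrimeOdd

/-- **`g(p) = #2Cl(ℚ(√−p))` is odd for every prime `p ≡ 3 (mod 4)`**: `disc = −p`, one prime discriminant,
`RM(−p)` is `1 × 1`, `r₄ = t − 1 − rank = 0` (Rédei–Reichardt, tree theorem).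
[cite: LiMa2008, Thm. 0.4 with Lemma 0.1 (D = −p)] [cite: Smith2016CongruentDensity, §2 Table 2 (chunk p0005 L26–L31)] -/
theorem odd_genusClassNumber_genusField_prime_three_mod_four {q : ℕ} (hq : q.Prime) (h3 : q % 4 = 3) :
    Odd (genusClassNumber (GenusField q)) := by
  have hprime : ∀ i, ((![q] : Fin 1 → ℕ) i).Prime := fun i => by fin_cases i; exact hq
  have hinj : Function.Injective (![q] : Fin 1 → ℕ) := Function.injective_of_subsingleton _
  have hprod : ∏ i, (![q] : Fin 1 → ℕ) i = if q % 4 = 1 then 2 * q else q := by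
    rw [if_neg (by omega), prod_vec_one]
  rw [odd_genusClassNumber_iff_of_redeiReichardt redeiReichardt_fourTwoCard_classGroup_holds hprime hinj hprod
    (GenusField q) (isQuadraticFieldOfSqrt_genusField hq.one_lt.le)]
  omega

/-- **Smith's Thm. 2.2 row `3` HOLDS for one prime factor**: for a prime `p ≡ 3 (mod 8)`,
`ℒ₃(p) = g(p) ≡ 1 ≡ det M (mod 2)` (`g(p)` odd; `det M = 1`, Genocchi's `p₃`, tree theorem
`det_monskyMatrixOdd_three_mod_eight`). [cite: Smith2016CongruentDensity, Thm. 2.2 row 3 (chunk p0005 L59–L75)]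
[cite: Feng1996NonCongruent, §1 p. 72 (Genocchi: p₃)] -/
theorem smith_thm22_rowThree_prime {q : ℕ} (hq : q.Prime) (h8 : q % 8 = 3) :
    ((genusSum₁ q (fun d => genusClassNumber (GenusField d)) : ℕ) : ZMod 2) = (monskyMatrixOdd ![q]).det := by
  rw [Families.det_monskyMatrixOdd_three_mod_eight h8, genusSum₁_eq_self hq.one_lt (fun d hd h1 hlt => ?_),
    ZMod.natCast_eq_one_iff_odd]
  · exact odd_genusClassNumber_genusField_prime_three_mod_four hq (by omega)
  · exfalso
    rcases (Nat.dvd_prime hq).mp hd with rfl | rfl <;> omega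

/-- **`smith_thm22_rowThree` restricted to `k = 1` holds.** [cite: Smith2016CongruentDensity, Thm. 2.2 row 3 (chunk p0005 L59–L63)] -/
theorem smith_thm22_rowThree_of_one (p : Fin 1 → ℕ) (hp : ∀ i, (p i).Prime) (h8 : (∏ i, p i) % 8 = 3) :
    ((genusSum₁ (∏ i, p i) (fun d => genusClassNumber (GenusField d)) : ℕ) : ZMod 2) =
      (monskyMatrixOdd p).det := by
  have hpe : p = ![p 0] := by ext i; fin_cases i; rfl
  have hprod : ∏ i, p i = p 0 := by rw [Fin.prod_univ_succ, Fin.prod_univ_zero, mul_one]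
  rw [hprod] at h8 ⊢
  rw [hpe]
  simpa using smith_thm22_rowThree_prime (hp 0) h8

end OnePrimeOdd

/-! ## §3 One odd prime: `n = 2p ≡ 2 (mod 8)` — row `2` HOLDS -/

section OnePrimeEven

/-- `∏ (![2, p]) = 2p` is the Rédei-tuple product of `ℚ(√−2p)` (`2p ≢ 1 (mod 4)`). [cite: LiMa2008, Lemma 0.1 (D = −8p)] -/
theorem prod_vec_two_cons (q : ℕ) :
    ∏ i, (![2, q] : Fin 2 → ℕ) i = if (2 * q) % 4 = 1 then 2 * (2 * q) else 2 * q := by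
  rw [if_neg (by omega), Families.prod_vecPair]

/-- **The Rédei matrix of `ℚ(√−2p)`, `p ≡ 1 (mod 4)`**: `RM(−8p) = a·(1 1; 1 1)` with `a = [(2/p) = −1]`
(column of `p`: `[(2/p) = −1]` and `[((2p/p)/p) = −1] = [(2/p) = −1]` by `redeiMatrix_transpose_apply`; column of
`2` by the vanishing row sums). [cite: LiMa2008, Def. 0.2 with Lemma 0.1 (D = −8p)] -/
theorem redeiMatrix_two_mul_prime_apply {q : ℕ} (hq : q.Prime) (hq2 : q ≠ 2) (i j : Fin 2) :
    redeiMatrix (2 * q) ![2, q] i j = if jacobiSym 2 q = -1 then 1 else 0 := by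
  have hprime : ∀ i, ((![2, q] : Fin 2 → ℕ) i).Prime := fun i => by
    fin_cases i
    · exact Nat.prime_two
    · exact hq
  have hinj : Function.Injective (![2, q] : Fin 2 → ℕ) := Families.injective_vecPair hq2.symm
  have hcol1 : ∀ j' : Fin 2, redeiMatrix (2 * q) ![2, q] j' 1 = if jacobiSym 2 q = -1 then 1 else 0 := by
    intro j'
    rw [redeiMatrix_transpose_apply hprime hinj (prod_vec_two_cons q) (i := 1) (by simpa using hq2) j']
    fin_cases j'
    · simp
    · simp [Nat.mul_div_cancel _ hq.pos]
  -- the column of `2` from the vanishing row sums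
  have hrow : ∀ i' : Fin 2, redeiMatrix (2 * q) ![2, q] i' 0 + redeiMatrix (2 * q) ![2, q] i' 1 = 0 := by
    intro i'
    have h := congr_fun (redeiMatrix_mulVec_one (2 * q) ![2, q]) i'
    rw [Matrix.mulVec, dotProduct, Pi.zero_apply, Fin.sum_univ_two] at h
    simpa using h
  have h01 : ∀ c d : ZMod 2, c + d = 0 → c = d := by decide
  fin_cases j
  · exact (h01 _ _ (hrow i)).trans (hcol1 i)
  · exact hcol1 i

/-- **`g(2p)` for a prime `p ≡ 1 (mod 4)` is odd iff `p ≡ 5 (mod 8)`** (`RM(−8p) = 0` for `p ≡ 1 (8)`: `r₄ = 1`;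
`= (1 1; 1 1)` for `p ≡ 5 (8)`: `r₄ = 0`), by Rédei–Reichardt (tree theorem).
[cite: LiMa2008, Thm. 0.4 (Rédei–Reichardt)] [cite: Smith2016CongruentDensity, §2 Table 2 (chunk p0005 L26–L31)] -/
theorem odd_genusClassNumber_genusField_two_mul_prime_iff {q : ℕ} (hq : q.Prime) (h4 : q % 4 = 1) :
    Odd (genusClassNumber (GenusField (2 * q))) ↔ q % 8 = 5 := by
  have hq2 : q ≠ 2 := by rintro rfl; norm_num at h4
  have hprime : ∀ i, ((![2, q] : Fin 2 → ℕ) i).Prime := fun i => by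
    fin_cases i
    · exact Nat.prime_two
    · exact hq
  have hinj : Function.Injective (![2, q] : Fin 2 → ℕ) := Families.injective_vecPair hq2.symm
  rw [odd_genusClassNumber_iff_card_ker_eq_two redeiReichardt_fourTwoCard_classGroup_holds hprime hinj
    (prod_vec_two_cons q) (GenusField (2 * q)) (isQuadraticFieldOfSqrt_genusField (by omega))]
  have hRM : redeiMatrix (2 * q) ![2, q] = Matrix.of fun _ _ => (if jacobiSym 2 q = -1 then (1 : ZMod 2) else 0) := by
    ext i j; rw [redeiMatrix_two_mul_prime_apply hq hq2, Matrix.of_apply]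
  have h8 : q % 8 = 1 ∨ q % 8 = 5 := by omega
  rcases h8 with h | h
  · have hj : jacobiSym 2 q = 1 := Families.jacobiSym_two_eq_one (Or.inl h)
    have hRM' : redeiMatrix (2 * q) ![2, q] = !![0, 0; 0, 0] := by
      rw [hRM, hj]; ext i j; fin_cases i <;> fin_cases j <;> simp
    rw [hRM']
    constructor
    · intro hc; exfalso; revert hc; decide
    · intro hc; omega
  · have hj : jacobiSym 2 q = -1 := Families.jacobiSym_two_eq_neg_one (Or.inr h)
    have hRM' : redeiMatrix (2 * q) ![2, q] = !![1, 1; 1, 1] := by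
      rw [hRM, hj]; ext i j; fin_cases i <;> fin_cases j <;> simp
    rw [hRM']
    constructor
    · intro _; exact h
    · intro _; decide

/-- **Smith's Thm. 2.2 row `2` HOLDS for one odd prime factor**: for a prime `p ≡ 1 (mod 4)`,
`ℒ₂(2p) ≡ det M (mod 2)` — for `p ≡ 5 (8)` both are `1` (`ℒ₂(2p) = g(2p)` odd; `det M = 1`, Genocchi's `2p₅`),
for `p ≡ 1 (8)` both are `0` (every decomposition of `2p` contains `p` or `2p`, whose `g` is even; `s(2p) = 2`).
[cite: Smith2016CongruentDensity, Thm. 2.2 row 2 (chunk p0005 L59–L75)] [cite: HeathBrown1994SelmerCongruentII, §1 typescript p. 6 L26–L28]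
[cite: Feng1996NonCongruent, §1 p. 72 (Genocchi: 2p₅)] -/
theorem smith_thm22_rowTwo_prime {q : ℕ} (hq : q.Prime) (h4 : q % 4 = 1) :
    ((genusSum₁ (2 * q) (fun d => genusClassNumber (GenusField d)) : ℕ) : ZMod 2) =
      (monskyMatrixEven ![q]).det := by
  have hq2 : q ≠ 2 := by rintro rfl; norm_num at h4
  have h2q : 1 < 2 * q := by have := hq.one_lt; omega
  have h8 : q % 8 = 1 ∨ q % 8 = 5 := by omega
  rcases h8 with h1 | h5
  · -- both sides vanish
    have hdet : (monskyMatrixEven ![q]).det = 0 := by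
      have hodd : ∀ i, Odd ((![q] : Fin 1 → ℕ) i) := fun i => by fin_cases i; exact hq.odd_of_ne_two hq2
      rw [det_eq_zero_iff_ne_one, Ne, ← monskySelmerRankEven_eq_zero_iff_det, monskySelmerRankEven_prime hq hq2,
        if_pos h1]
      decide
    have hgq : Even (genusClassNumber (GenusField q)) := even_genusClassNumber_genusField_prime hq h1
    have hg2q : Even (genusClassNumber (GenusField (2 * q))) := by
      rw [← Nat.not_odd_iff_even, odd_genusClassNumber_genusField_two_mul_prime_iff hq h4]; omega
    rw [hdet, ZMod.natCast_eq_zero_iff_even]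
    unfold genusSum₁
    refine Finset.even_sum _ fun D hD => ?_
    rw [Finset.mem_filter] at hD
    have hD' := hD.1
    simp only [decompositions, Finset.mem_filter, Finset.mem_powerset] at hD'
    obtain ⟨hsub, hgt, -, hprod⟩ := hD'
    -- some member of `D` is `p` or `2p`
    have hmem : q ∈ D ∨ 2 * q ∈ D := by
      by_contra hnot
      rw [not_or] at hnot
      have hall : ∀ d ∈ D, d = 2 := fun d hd => by
        have hdvd : d ∣ 2 * q := Nat.dvd_of_mem_divisors (hsub hd)
        rcases eq_of_dvd_prime_mul_prime Nat.prime_two hq hdvd with rfl | rfl | rfl | rfl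
        · exact absurd (hgt 1 hd) (by omega)
        · rfl
        · exact absurd hd hnot.1
        · exact absurd hd hnot.2
      have hD2 : D ⊆ {2} := fun d hd => Finset.mem_singleton.mpr (hall d hd)
      have hq2' := hq.two_le
      rcases Finset.subset_singleton_iff.mp hD2 with rfl | rfl
      · rw [Finset.prod_empty] at hprod; omega
      · rw [Finset.prod_singleton] at hprod; omega
    rcases hmem with hd | hd
    · exact even_iff_two_dvd.mpr ((even_iff_two_dvd.mp hgq).trans (Finset.dvd_prod_of_mem _ hd))
    · exact even_iff_two_dvd.mpr ((even_iff_two_dvd.mp hg2q).trans (Finset.dvd_prod_of_mem _ hd))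
  · -- both sides are `1`
    rw [Families.det_monskyMatrixEven_five_mod_eight h5, genusSum₁_eq_self h2q (fun d hd h1 hlt => ?_),
      ZMod.natCast_eq_one_iff_odd]
    · exact (odd_genusClassNumber_genusField_two_mul_prime_iff hq h4).mpr h5
    · rcases eq_of_dvd_prime_mul_prime Nat.prime_two hq hd with rfl | rfl | rfl | rfl <;> omega

/-- **`smith_thm22_rowTwo` restricted to `k = 1` holds.** [cite: Smith2016CongruentDensity, Thm. 2.2 row 2 (chunk p0005 L59–L63)] -/
theorem smith_thm22_rowTwo_of_one (p : Fin 1 → ℕ) (hp : ∀ i, (p i).Prime) (h4 : (∏ i, p i) % 4 = 1) :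
    ((genusSum₁ (2 * ∏ i, p i) (fun d => genusClassNumber (GenusField d)) : ℕ) : ZMod 2) =
      (monskyMatrixEven p).det := by
  have hpe : p = ![p 0] := by ext i; fin_cases i; rfl
  have hprod : ∏ i, p i = p 0 := by rw [Fin.prod_univ_succ, Fin.prod_univ_zero, mul_one]
  rw [hprod] at h4 ⊢
  rw [hpe]
  simpa using smith_thm22_rowTwo_prime (hp 0) h4

/-- **For a prime `p ≡ 1 (mod 4)`: `rank E_{2p}(ℚ) = 0 ∧ Ш(E_{2p}/ℚ)[2^∞] = 0 ⟺ p ≡ 5 (mod 8)`**, unconditionally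
(`s(2p) = 0` for `p ≡ 5 (8)`, Genocchi; `s(2p) = 2` for `p ≡ 1 (8)`, so positive rank or non-trivial `Ш[2^∞]`).
[cite: HeathBrown1994SelmerCongruentII, §1 typescript p. 6 L26–L28 (s(2p) = 2, 1, 0, 1)]
[cite: Feng1996NonCongruent, §1 p. 72 (Genocchi: 2p₅)] [cite: SilvermanAEC2009, Thm. X.4.2] -/
theorem rank_zero_and_sha_two_mul_prime_iff_five_mod_eight {q : ℕ} (hq : q.Prime) (h4 : q % 4 = 1) :
    ((haveI := isElliptic_congruentNumberCurve (mul_ne_zero two_ne_zero hq.ne_zero);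
        (congruentNumberCurve (2 * q)).mordellWeilRank = 0) ∧
      (haveI := isElliptic_congruentNumberCurve (mul_ne_zero two_ne_zero hq.ne_zero);
        AddCommGroup.primaryComponent (congruentNumberCurve (2 * q)).sha 2 = ⊥)) ↔ q % 8 = 5 := by
  have hq2 : q ≠ 2 := by rintro rfl; norm_num at h4
  have hodd : ∀ i, Odd ((![q] : Fin 1 → ℕ) i) := fun i => by fin_cases i; exact hq.odd_of_ne_two hq2
  have hprime : ∀ i, ((![q] : Fin 1 → ℕ) i).Prime := fun i => by fin_cases i; exact hq
  have hinj : Function.Injective (![q] : Fin 1 → ℕ) := Function.injective_of_subsingleton _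
  rw [← card_selmerGroup_two_eq_four_iff_rank_zero_and_sha (mul_ne_zero two_ne_zero hq.ne_zero),
    card_selmerGroup_two_eq_four_iff_det_monskyMatrixEven' ![q] (by rw [prod_vec_one]) hprime hodd hinj,
    ← monskySelmerRankEven_eq_zero_iff_det, monskySelmerRankEven_prime hq hq2]
  have h8 : q % 8 = 1 ∨ q % 8 = 5 := by omega
  rcases h8 with h | h <;> simp [h]

end OnePrimeEven

end Literature.NumberTheory.EllipticCurves.Smith2016
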